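import Literature.AlgebraicGeometry.HodgeTheory.AbelianVarietyTorsionPointsHomology
import Literature.AlgebraicGeometry.HodgeTheory.AbelianVarietyRationalCharpoly
import Literature.AlgebraicGeometry.Motives.AbelianVarietyIsogenyCovering
import Literature.Algebra.Module.DedekindLatticeIdealQuotientCard
import HarnessLib

/-!
# Ideal-torsion points of a complex abelian variety with multiplication by a Dedekind `ℤ`-order:
# `#A[𝔞](ℂ) = N𝔞 ^ (2 dim A ∕ rk_ℤ 𝒪)` and `rk_ℤ 𝒪 ∣ 2 dim A` ([Shimura1998] §7.5 p. 72: "`𝔤(𝔞, A)` is of order `N(𝔞)^m`")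

Topic `Literature/AlgebraicGeometry/HodgeTheory`; namespace `Literature.AlgebraicGeometry.HodgeTheory.AbelianVariety` (sequel of ★
`AbelianVarietyTorsionPointsHomology`: `H₁(A(ℂ); ℤ)⧸n ≃ A[n](ℂ)`, natural in homomorphisms).  THEOREMS ONLY (no definition, no named fact, no
`instance`, no notation, no `sorry`).  Cell `hodgecm-mathlib` (D-0151), FLOOR 0, P6 «MOD programme» (crux hLiu418 = stmt-HodgeConjecture-24832,
`--supports`, count-neutral): organ **(LAT-A) «IDEAL-TORSION COUNT OVER `ℂ`»** of the GENERIC-FIBRE road (LDEAL v1 §L1 T2: «the characteristic-0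
`𝒪⧸𝔭`-module structure of `A_K[𝔭](K̄)`, rank `N𝔭^{2g∕[F:ℚ]}`»; H4 ORDER-INPUT census of line L3, item (2)): the geometric half that turns the
lattice count ★ `Algebra/Module/DedekindLatticeIdealQuotientCard` (organ (LAT): `#{x ∈ Λ⧸nΛ | 𝔞x = 0} = N𝔞^{rk Λ}` along any presentation of
`Λ⧸nΛ`) into a statement about the complex points of an abelian variety.  HC_CM is proved only modulo the printed citations (2 remaining named
inputs hLiu418 24832, h413 24833) until rung 0 closes; this file is generic and changes no count.

THE MATHEMATICS ([Shimura1998] §7.1 (1), §7.5 p. 72 L1–L3: for `(A, ι)` of type `(F)` and index `m`, `2 dim A = m [F : ℚ]`, and an ideal `𝔞`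
prime to the characteristic, "`𝔤(𝔞, A)` is of order `N(𝔞)^m`"; [BirkenhakeLange2004] §1.1: `A(ℂ) = V⧸Λ`, `A[n] = n⁻¹Λ⧸Λ ≅ Λ⧸nΛ`).  Let `A` be a
complex abelian variety, `𝒪` a Dedekind domain finite free over `ℤ` (e.g. the ring of integers of a number field) and `θ : 𝒪 → End A` a ring
homomorphism.  Push-forward on `Λ := H₁(A(ℂ); ℤ) ≅ ℤ^{2 dim A}` is a RING homomorphism `ρ_r : End A → End_ℤ Λ` (§1: functoriality of `H₁`
and ★ `singularHomology_int_map_add_one`, Eckmann–Hilton), so `Λ` is an `𝒪`-module through `ρ_r ∘ θ`; it is finitely generated (over `ℤ`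
already) and TORSION-FREE over `𝒪` (§2: if `r ≠ 0` kills `x` then so does `N(r) = r·r' ∈ ℤ ∖ 0`, and `Λ` is free over `ℤ`).  For `0 ≠ n ∈ 𝔞`
the monodromy isomorphism `Λ⧸nΛ ≃ A[n](ℂ)` of ★ `modNHOneEquivTorsionPoints` intertwines `θ(a)_*` with `θ(a)` (★
`coe_modNHOneEquivTorsionPoints_mkQ_map`), so it is a presentation of `Λ⧸nΛ` inside `A(ℂ)` in the sense of ★ (LAT) §5, whose image `A[n](ℂ)`
contains the `𝔞`-torsion (`θ(n) = n_A`); hence **`#{t ∈ A(ℂ) | θ(𝔞) t = 1} = N𝔞 ^ rk_𝒪 Λ`** (§3).  Taking `𝔞 = (2)`: `#A[2](ℂ) = 2^{2 dim A}`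
(★ `natCard_torsionPoints_complex`) and `N((2)) = 2^{rk_ℤ 𝒪}` give **`rk_ℤ 𝒪 · rk_𝒪 Λ = 2 dim A`** (§3), i.e. `[F:ℚ] ∣ 2 dim A` and
`rk_𝒪 Λ = m` is Shimura's index; §4 states the count and the divisibility free of the auxiliary module structure.

RELATED TREE STATEMENTS (other carriers, neither used nor restated): the complex-TORUS count for any index ★
`Geometry/Kaehler/ComplexTorusIdealTorsionCountAnyIndex` (`X = E⧸P(ℤ^ι)`, `ρ : 𝓞 K → Matrix ι ι ℤ`; with the lattice index ★
`NumberTheory/ComplexMultiplication/LatticeIdealColonIndex`), and the INDEX-ONE count over any field ★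
`AlgebraicGeometry/ComplexMultiplication/IdealSectionPoints` (`natCard_idealSectionPoints`, `[F:ℚ] = 2 dim A`, `ℓ`-adic).  The present file is
the algebraic-carrier (`Motives.AbelianVariety ℂ`, `A.Points ℂ`) statement for ANY index, through `H₁`.

## Contents
* §1 `hom_singularHomology_map_comp_one`, `hom_singularHomology_map_id_one`, **`exists_ringHom_singularHomology_map_one`** (`ρ_r` is a ring hom),
  `map_natCast_eq_zsmul_id` (`θ(n) = n_A`), `monoidHom_map_natCast_apply` (`θ(n) t = tⁿ`).
* §2 (any `𝒪`-module structure on `H₁` with `a • x = θ(a)_* x`) `moduleFinite_singularHomology_of_smul_eq`, `natCast_smul_eq_of_smul_eq`,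
  `isTorsionFree_singularHomology_of_smul_eq`.
* §3 **`natCard_idealTorsion_eq_absNorm_pow_finrank`** (`#{t | θ(𝔞)t = 1} = N𝔞 ^ rk_𝒪 H₁`), **`finrank_int_mul_finrank_eq_two_mul_dim`**.
* §4 (instance-free) **`finrank_int_dvd_two_mul_dim`** (`rk_ℤ 𝒪 ∣ 2 dim A`), **`natCard_idealTorsion_eq_absNorm_pow`** (`#{t | θ(𝔞)t = 1} = N𝔞 ^ (2 dim A ∕ rk_ℤ 𝒪)`).

## References
* [Shimura1998] G. Shimura, *Abelian Varieties with Complex Multiplication and Modular Functions*, Princeton (1998), §7.1 (1) (the index), §7.5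
  p. 72 L1–L3 ("`𝔤(𝔞, A)` is of order `N(𝔞)^m`"), Prop. 18–19.
* [BirkenhakeLange2004] C. Birkenhake, H. Lange, *Complex Abelian Varieties*, 2nd ed. (2004), §1.1 (`X_n ≅ Λ⧸nΛ`), §1.2 (`ρ_r`).
* [Lange2023AbelianVarietiesComplex] H. Lange, *Abelian Varieties over the Complex Numbers* (2023), §1.1.2 Prop. 1.1.14 (`X_n ≃ (ℤ⧸nℤ)^{2g}`).
-/

set_option autoImplicit false

noncomputable section

open Module CategoryTheory Function AlgebraicGeometry
open Literature.AlgebraicTopology.SingularHomology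
open Literature.AlgebraicTopology.FundamentalGroup
open scoped MonObj Pointwise

universe u

namespace Literature.AlgebraicGeometry.HodgeTheory.AbelianVariety

open Literature.AlgebraicGeometry.Motives Literature.AlgebraicGeometry.Motives.AbelianVariety
open Literature.Algebra.Module.DedekindLattice

variable {A : Motives.AbelianVariety ℂ}

/-! ## §1 `ρ_r : End A → End_ℤ H₁(A(ℂ); ℤ)` is a ring homomorphism -/

/-- `ρ_r(f ≫ g) = ρ_r(g) ∘ ρ_r(f)` on `H₁(A(ℂ); ℤ)` (functoriality of `H₁` and of `A ↦ A(ℂ)`). [cite: BirkenhakeLange2004, §1.2 (the rational representation)] -/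
theorem hom_singularHomology_map_comp_one (f g : A ⟶ A) :
    (singularHomology.map ℤ ℤ (AlgPoints.mapContinuous (L := ℂ) (f ≫ g).hom.hom.hom) 1).hom =
      (singularHomology.map ℤ ℤ (AlgPoints.mapContinuous (L := ℂ) g.hom.hom.hom) 1).hom.comp
        (singularHomology.map ℤ ℤ (AlgPoints.mapContinuous (L := ℂ) f.hom.hom.hom) 1).hom := by
  rw [show (f ≫ g).hom.hom.hom = f.hom.hom.hom ≫ g.hom.hom.hom from rfl, AlgPoints.mapContinuous_comp,
    singularHomology.map_comp, ModuleCat.hom_comp]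

/-- `ρ_r(𝟙_A) = id` on `H₁(A(ℂ); ℤ)`. [cite: BirkenhakeLange2004, §1.2 (the rational representation)] -/
theorem hom_singularHomology_map_id_one (A : Motives.AbelianVariety ℂ) :
    (singularHomology.map ℤ ℤ (AlgPoints.mapContinuous (L := ℂ) (𝟙 A : A ⟶ A).hom.hom.hom) 1).hom = LinearMap.id := by
  rw [show (𝟙 A : A ⟶ A).hom.hom.hom = 𝟙 A.X from rfl, AlgPoints.mapContinuous_id, singularHomology.map_id,
    ModuleCat.hom_id]

/-- **`ρ_r : End A → End_ℤ H₁(A(ℂ); ℤ)`, `f ↦ f_*`, is a RING homomorphism** (additive by ★ `singularHomology_int_map_add_one`, multiplicative by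
functoriality; `f * g = g ≫ f` in `End A` and `ρ_r(g ≫ f) = ρ_r(f) ∘ ρ_r(g)`), stated as an existence so that no definition is introduced.
[cite: BirkenhakeLange2004, §1.2 (the rational representation `ρ_r : End(X) → End_ℤ(Λ)`)] -/
theorem exists_ringHom_singularHomology_map_one (A : Motives.AbelianVariety ℂ) :
    ∃ ρ : End A →+* Module.End ℤ (singularHomology ℤ ℤ (A.Points ℂ) 1),
      ∀ f, ρ f = (singularHomology.map ℤ ℤ (AlgPoints.mapContinuous (L := ℂ) f.hom.hom.hom) 1).hom := by
  have h0 : (singularHomology.map ℤ ℤ (AlgPoints.mapContinuous (L := ℂ) (0 : A ⟶ A).hom.hom.hom) 1).hom = 0 := by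
    rw [singularHomology_int_map_zero_one]; rfl
  have hadd : ∀ f g : A ⟶ A,
      (singularHomology.map ℤ ℤ (AlgPoints.mapContinuous (L := ℂ) (f + g).hom.hom.hom) 1).hom =
        (singularHomology.map ℤ ℤ (AlgPoints.mapContinuous (L := ℂ) f.hom.hom.hom) 1).hom +
          (singularHomology.map ℤ ℤ (AlgPoints.mapContinuous (L := ℂ) g.hom.hom.hom) 1).hom := by
    intro f g
    rw [singularHomology_int_map_add_one]; rfl
  exact ⟨{ toFun := fun f => (singularHomology.map ℤ ℤ (AlgPoints.mapContinuous (L := ℂ) f.hom.hom.hom) 1).hom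
           map_one' := hom_singularHomology_map_id_one A
           map_mul' := fun f g => hom_singularHomology_map_comp_one g f
           map_zero' := h0
           map_add' := fun f g => hadd f g }, fun _ => rfl⟩

section NatCast

variable {O : Type u} [CommRing O] (θ : O →+* End A)

/-- `θ(n) = n_A` (`= (n : ℤ) • 𝟙 A`) for a natural number `n` and a ring homomorphism `θ : 𝒪 → End A`. [cite: Shimura1998, §7.1 (1)] -/
theorem map_natCast_eq_zsmul_id (n : ℕ) : (θ n : A ⟶ A) = (n : ℤ) • 𝟙 A := by
  rw [map_natCast]
  change ((n : End A)) = (n : ℤ) • (1 : End A)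
  rw [zsmul_one, Int.cast_natCast]

/-- `θ(n)` acts on `A(ℂ)` as `t ↦ tⁿ` (★ `monoidHom_zsmul_id_apply`). [cite: Shimura1998, §7.1 (1)] -/
theorem monoidHom_map_natCast_apply (n : ℕ) (t : A.Points ℂ) :
    IsMonHom.monoidHom (θ n).hom.hom.hom (specOver ℂ ℂ) t = t ^ n := by
  have h := monoidHom_zsmul_id_apply (A := A) n t
  rw [← map_natCast_eq_zsmul_id θ n] at h
  exact h

end NatCast

/-! ## §2 `H₁(A(ℂ); ℤ)` as an `𝒪`-module through `θ : 𝒪 → End A` -/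

section Module

variable {O : Type u} [CommRing O] (θ : O →+* End A)
  [Module O (singularHomology ℤ ℤ (A.Points ℂ) 1)]

/-- `H₁(A(ℂ); ℤ)` is a finitely generated `𝒪`-module for any `𝒪`-module structure in which `a` acts as `θ(a)_*` (it is finitely generated over `ℤ`,
★ `finite_singularHomology_int`, and `(n • a) • x = n • (a • x)` by ★ `singularHomology_int_map_zsmul_one`). [cite: BirkenhakeLange2004, §1.2] -/
theorem moduleFinite_singularHomology_of_smul_eq
    (hsmul : ∀ (a : O) (x : singularHomology ℤ ℤ (A.Points ℂ) 1),
      a • x = (singularHomology.map ℤ ℤ (AlgPoints.mapContinuous (L := ℂ) (θ a).hom.hom.hom) 1).hom x) :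
    Module.Finite O (singularHomology ℤ ℤ (A.Points ℂ) 1) := by
  refine @Module.Finite.of_restrictScalars_finite ℤ O _ _ _ _ (singularHomology ℤ ℤ (A.Points ℂ) 1).isModule _ _
    (@IsScalarTower.mk ℤ O _ _ _ (singularHomology ℤ ℤ (A.Points ℂ) 1).isModule.toSMul fun n a x => ?_)
    (finite_singularHomology_int A 1)
  change (n • a) • x = @SMul.smul ℤ _ (singularHomology ℤ ℤ (A.Points ℂ) 1).isModule.toSMul n (a • x)
  rw [int_smul_eq_zsmul, hsmul, hsmul, map_zsmul θ n a]
  have h := congrArg ModuleCat.Hom.hom (singularHomology_int_map_zsmul_one n (θ a : A ⟶ A))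
  rw [ModuleCat.hom_zsmul] at h
  exact LinearMap.congr_fun h x

/-- the scalar `(n : 𝒪)` acts on `H₁(A(ℂ); ℤ)` as multiplication by `n` (`θ(n) = n_A` and `(n_A)_* = n`, ★ `singularHomology_int_map_zsmul_id_one_apply`).
[cite: BirkenhakeLange2004, §1.2] -/
theorem natCast_smul_eq_of_smul_eq
    (hsmul : ∀ (a : O) (x : singularHomology ℤ ℤ (A.Points ℂ) 1),
      a • x = (singularHomology.map ℤ ℤ (AlgPoints.mapContinuous (L := ℂ) (θ a).hom.hom.hom) 1).hom x)
    (n : ℕ) (x : singularHomology ℤ ℤ (A.Points ℂ) 1) : (n : O) • x = (n : ℤ) • x := by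
  rw [hsmul, map_natCast_eq_zsmul_id θ n]
  exact singularHomology_int_map_zsmul_id_one_apply A n x

/-- `H₁(A(ℂ); ℤ)` is TORSION-FREE over a Dedekind domain `𝒪` finite free over `ℤ` acting through `θ`: if `r ≠ 0` and `r • x = 0` then
`N((r)) • x = 0` with `0 ≠ N((r)) = r'·r ∈ ℕ` (Mathlib `Ideal.absNorm_mem`), and `H₁` is free over `ℤ` (★ `free_singularHomology_int`). [cite: Shimura1998, §7.5 p. 72] -/
theorem isTorsionFree_singularHomology_of_smul_eq [IsDedekindDomain O] [Module.Free ℤ O] [Module.Finite ℤ O]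
    (hsmul : ∀ (a : O) (x : singularHomology ℤ ℤ (A.Points ℂ) 1),
      a • x = (singularHomology.map ℤ ℤ (AlgPoints.mapContinuous (L := ℂ) (θ a).hom.hom.hom) 1).hom x) :
    Module.IsTorsionFree O (singularHomology ℤ ℤ (A.Points ℂ) 1) := by
  haveI : Module.Free ℤ (singularHomology ℤ ℤ (A.Points ℂ) 1) := free_singularHomology_int A 1
  refine Module.IsTorsionFree.of_smul_eq_zero fun r m hrm => ?_
  by_cases hr : r = 0
  · exact Or.inl hr
  right
  set N : ℕ := Ideal.absNorm (Ideal.span {r}) with hN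
  have hN0 : N ≠ 0 := by
    rw [hN, Ne, Ideal.absNorm_eq_zero_iff, Ideal.span_singleton_eq_bot]
    exact hr
  obtain ⟨b, hb⟩ := Ideal.mem_span_singleton'.mp (Ideal.absNorm_mem (Ideal.span {r}))
  have h1 : (N : O) • m = 0 := by
    rw [hN, ← hb, mul_smul, hrm, smul_zero]
  rw [natCast_smul_eq_of_smul_eq θ hsmul, ← int_smul_eq_zsmul (singularHomology ℤ ℤ (A.Points ℂ) 1).isModule] at h1
  rcases smul_eq_zero.mp h1 with h | h
  · exact absurd (by exact_mod_cast h) hN0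
  · exact h

end Module

/-! ## §3 The count through a module structure on `H₁(A(ℂ); ℤ)` compatible with `θ` -/

section Count

variable {O : Type u} [CommRing O] [IsDedekindDomain O] [Module.Free ℤ O] [Module.Finite ℤ O] (θ : O →+* End A)
  [Module O (singularHomology ℤ ℤ (A.Points ℂ) 1)]

/-- **`#{t ∈ A(ℂ) | θ(𝔞) t = 1} = N𝔞 ^ rk_𝒪 H₁(A(ℂ); ℤ)`** for every nonzero ideal `𝔞` of a Dedekind domain `𝒪` finite free over `ℤ` acting on the
complex abelian variety `A` through `θ : 𝒪 → End A`, for any `𝒪`-module structure on `H₁(A(ℂ); ℤ)` in which `a` acts as `θ(a)_*`: the monodromy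
isomorphism `H₁⧸N ≃ A[N](ℂ)` (`N = N𝔞 ∈ 𝔞`, ★ `modNHOneEquivTorsionPoints`, equivariant by ★ `coe_modNHOneEquivTorsionPoints_mkQ_map`) is a
presentation of `H₁⧸N H₁` inside `A(ℂ)` whose image contains the `𝔞`-torsion, and ★ (LAT) `natCard_subtype_torsion_of_presentation_eq_absNorm_pow`
counts. [cite: Shimura1998, §7.5 p. 72 ("`𝔤(𝔞, A)` is of order `N(𝔞)^m`")] -/
theorem natCard_idealTorsion_eq_absNorm_pow_finrank
    (hsmul : ∀ (a : O) (x : singularHomology ℤ ℤ (A.Points ℂ) 1),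
      a • x = (singularHomology.map ℤ ℤ (AlgPoints.mapContinuous (L := ℂ) (θ a).hom.hom.hom) 1).hom x)
    (𝔞 : Ideal O) (h𝔞 : 𝔞 ≠ ⊥) :
    Nat.card {t : A.Points ℂ // ∀ a ∈ 𝔞, IsMonHom.monoidHom (θ a).hom.hom.hom (specOver ℂ ℂ) t = 1} =
      Ideal.absNorm 𝔞 ^ finrank O (singularHomology ℤ ℤ (A.Points ℂ) 1) := by
  haveI := moduleFinite_singularHomology_of_smul_eq θ hsmul
  haveI := isTorsionFree_singularHomology_of_smul_eq θ hsmul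
  -- a natural number `N ≠ 0` in `𝔞`
  set N : ℕ := Ideal.absNorm 𝔞 with hN
  have hN0 : N ≠ 0 := by rw [hN, Ne, Ideal.absNorm_eq_zero_iff]; exact h𝔞
  have hNmem : ((N : ℕ) : O) ∈ 𝔞 := Ideal.absNorm_mem 𝔞
  have hNO : ((N : ℕ) : O) ≠ 0 := by
    intro h
    have h1 : ((N : ℕ) : O) • (1 : O) = 0 := by rw [h, zero_smul]
    rw [Nat.cast_smul_eq_nsmul, ← natCast_zsmul] at h1
    rcases smul_eq_zero.mp h1 with h2 | h2
    · exact hN0 (by exact_mod_cast h2)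
    · exact one_ne_zero h2
  -- the presentation `π : H₁ → H₁⧸N ≃ A[N](ℂ) ⊆ A(ℂ)`
  set e := modNHOneEquivTorsionPoints A N hN0 with he
  let π : singularHomology ℤ ℤ (A.Points ℂ) 1 →+ Additive (A.Points ℂ) :=
    (MonoidHom.toAdditive (A.torsionPoints ℂ N).subtype).comp (e.toAddMonoidHom.comp (ModN.mkQ N))
  have hπ : ∀ x, π x = Additive.ofMul (((Additive.toMul (e (ModN.mkQ N x))) : A.torsionPoints ℂ N) : A.Points ℂ) :=
    fun x => rfl
  let ψ : O → Additive (A.Points ℂ) → Additive (A.Points ℂ) :=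
    fun a q => Additive.ofMul (IsMonHom.monoidHom (θ a).hom.hom.hom (specOver ℂ ℂ) (Additive.toMul q))
  have hker : ∀ x, π x = 0 ↔ x ∈ ((N : ℕ) : O) • (⊤ : Submodule O (singularHomology ℤ ℤ (A.Points ℂ) 1)) := by
    intro x
    rw [hπ, Submodule.mem_smul_pointwise_iff_exists]
    constructor
    · intro h
      have h1 : Additive.toMul (e (ModN.mkQ N x)) = 1 := by
        apply Subtype.ext
        exact h
      have h2 : ModN.mkQ N x = 0 := by
        rw [← e.map_eq_zero_iff]
        exact h1
      obtain ⟨y, hy⟩ := (modN_mkQ_eq_zero_iff N x).mp h2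
      refine ⟨y, Submodule.mem_top, ?_⟩
      rw [natCast_smul_eq_of_smul_eq θ hsmul, natCast_zsmul]
      exact hy
    · rintro ⟨y, -, rfl⟩
      have h2 : ModN.mkQ N (((N : ℕ) : O) • y) = 0 := by
        rw [modN_mkQ_eq_zero_iff]
        exact ⟨y, by rw [natCast_smul_eq_of_smul_eq θ hsmul, natCast_zsmul]⟩
      rw [h2, map_zero]
      rfl
  have hcomp : ∀ a x, π (a • x) = ψ a (π x) := by
    intro a x
    have hnat := coe_modNHOneEquivTorsionPoints_mkQ_map (θ a : A ⟶ A) N hN0 x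
    rw [hπ, hπ, hsmul]
    exact congrArg Additive.ofMul hnat
  have hrange : ∀ q, (∀ a ∈ 𝔞, ψ a q = 0) → ∃ x, π x = q := by
    intro q hq
    have h1 : IsMonHom.monoidHom (θ N).hom.hom.hom (specOver ℂ ℂ) (Additive.toMul q) = 1 := hq _ hNmem
    rw [monoidHom_map_natCast_apply θ N] at h1
    have h2 : Additive.toMul q ∈ A.torsionPoints ℂ N := by
      rw [mem_torsionPoints_iff, zpow_natCast]; exact h1
    obtain ⟨z, hz⟩ := e.surjective (Additive.ofMul ⟨Additive.toMul q, h2⟩)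
    obtain ⟨x, hx⟩ := Quot.exists_rep z
    refine ⟨x, ?_⟩
    rw [hπ]
    rw [show ModN.mkQ N x = z from hx, hz]
    rfl
  have hmain := natCard_subtype_torsion_of_presentation_eq_absNorm_pow ψ 𝔞 h𝔞 hNO hNmem π hker hcomp hrange
  rw [← hmain]
  exact Nat.card_congr (Equiv.subtypeEquiv Additive.ofMul fun t => Iff.rfl)

/-- **`rk_ℤ 𝒪 · rk_𝒪 H₁(A(ℂ); ℤ) = 2 dim A`** (Shimura's `2n = m·[F:ℚ]`, the index `m = rk_𝒪 H₁`): count the `(2)`-torsion both ways —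
`#A[2](ℂ) = 2^{2 dim A}` (★ `natCard_torsionPoints_complex`) and `= N((2))^{rk} = 2^{rk_ℤ 𝒪 · rk}` (§3 with Mathlib `Ideal.absNorm_span_singleton`,
`Algebra.norm_algebraMap`). [cite: Shimura1998, §7.1 (1)] -/
theorem finrank_int_mul_finrank_eq_two_mul_dim
    (hsmul : ∀ (a : O) (x : singularHomology ℤ ℤ (A.Points ℂ) 1),
      a • x = (singularHomology.map ℤ ℤ (AlgPoints.mapContinuous (L := ℂ) (θ a).hom.hom.hom) 1).hom x) :
    finrank ℤ O * finrank O (singularHomology ℤ ℤ (A.Points ℂ) 1) = 2 * A.dim := by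
  have h2O : ((2 : ℕ) : O) ≠ 0 := by
    intro h
    have h1 : ((2 : ℕ) : O) • (1 : O) = 0 := by rw [h, zero_smul]
    rw [Nat.cast_smul_eq_nsmul, ← natCast_zsmul] at h1
    rcases smul_eq_zero.mp h1 with h2 | h2
    · exact absurd h2 (by norm_num)
    · exact one_ne_zero h2
  have hne : Ideal.span {((2 : ℕ) : O)} ≠ ⊥ := by
    rw [Ne, Ideal.span_singleton_eq_bot]; exact h2O
  have hcount := natCard_idealTorsion_eq_absNorm_pow_finrank θ hsmul _ hne
  -- LHS = #A[2](ℂ) = 2 ^ (2 dim A)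
  have hL : Nat.card {t : A.Points ℂ // ∀ a ∈ Ideal.span {((2 : ℕ) : O)},
      IsMonHom.monoidHom (θ a).hom.hom.hom (specOver ℂ ℂ) t = 1} = 2 ^ (2 * A.dim) := by
    rw [← natCard_torsionPoints_complex A 2 two_ne_zero]
    refine Nat.card_congr (Equiv.subtypeEquivRight fun t => ?_)
    rw [mem_torsionPoints_iff, zpow_natCast, ← monoidHom_map_natCast_apply θ 2 t]
    constructor
    · intro h; exact h _ (Ideal.mem_span_singleton_self _)
    · intro h a ha
      obtain ⟨c, rfl⟩ := Ideal.mem_span_singleton'.mp ha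
      rw [map_mul]
      change IsMonHom.monoidHom ((θ ((2 : ℕ) : O) : A ⟶ A) ≫ (θ c : A ⟶ A)).hom.hom.hom (specOver ℂ ℂ) t = 1
      rw [monoidHom_comp_apply, h, map_one]
  -- RHS = (2 ^ rk_ℤ 𝒪) ^ rk
  have hR : Ideal.absNorm (Ideal.span {((2 : ℕ) : O)}) = 2 ^ finrank ℤ O := by
    rw [Ideal.absNorm_span_singleton, show ((2 : ℕ) : O) = algebraMap ℤ O 2 by simp, Algebra.norm_algebraMap]
    simp [Int.natAbs_pow]
  rw [hL, hR, ← pow_mul] at hcount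
  exact (Nat.pow_right_injective (le_refl 2) hcount).symm

end Count

/-! ## §4 The instance-free statements -/

section Main

variable {O : Type u} [CommRing O] [IsDedekindDomain O] [Module.Free ℤ O] [Module.Finite ℤ O]

/-- **`rk_ℤ 𝒪 ∣ 2 dim A`** whenever a Dedekind domain `𝒪` finite free over `ℤ` acts on the complex abelian variety `A` by a ring homomorphism
`θ : 𝒪 → End A` (Shimura: `fd ∣ 2n`). [cite: Shimura1998, §7.1 (1)] -/
theorem finrank_int_dvd_two_mul_dim (θ : O →+* End A) : finrank ℤ O ∣ 2 * A.dim := by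
  obtain ⟨ρ, hρ⟩ := exists_ringHom_singularHomology_map_one A
  letI : Module O (singularHomology ℤ ℤ (A.Points ℂ) 1) := Module.compHom _ (ρ.comp θ)
  have hsmul : ∀ (a : O) (x : singularHomology ℤ ℤ (A.Points ℂ) 1),
      a • x = (singularHomology.map ℤ ℤ (AlgPoints.mapContinuous (L := ℂ) (θ a).hom.hom.hom) 1).hom x := by
    intro a x
    change (ρ (θ a)) x = _
    rw [hρ]
  exact Dvd.intro _ (finrank_int_mul_finrank_eq_two_mul_dim θ hsmul)

/-- **THE COUNT `#{t ∈ A(ℂ) | θ(𝔞) t = 1} = N𝔞 ^ (2 dim A ∕ rk_ℤ 𝒪)`** ("`𝔤(𝔞, A)` is of order `N(𝔞)^m`", `m` the index): for a complex abelian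
variety `A`, a Dedekind domain `𝒪` finite free over `ℤ` (e.g. the ring of integers of a number field) acting through a ring homomorphism
`θ : 𝒪 → End A`, and a nonzero ideal `𝔞 ⊆ 𝒪`, the points `t ∈ A(ℂ)` killed by every `θ(a)`, `a ∈ 𝔞`, number `N𝔞 ^ (2 dim A ∕ rk_ℤ 𝒪)` (and
`rk_ℤ 𝒪 ∣ 2 dim A`, `finrank_int_dvd_two_mul_dim`). [cite: Shimura1998, §7.5 p. 72 ("`𝔤(𝔞, A)` is of order `N(𝔞)^m`")] -/
theorem natCard_idealTorsion_eq_absNorm_pow (θ : O →+* End A) (𝔞 : Ideal O) (h𝔞 : 𝔞 ≠ ⊥) :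
    Nat.card {t : A.Points ℂ // ∀ a ∈ 𝔞, IsMonHom.monoidHom (θ a).hom.hom.hom (specOver ℂ ℂ) t = 1} =
      Ideal.absNorm 𝔞 ^ (2 * A.dim / finrank ℤ O) := by
  obtain ⟨ρ, hρ⟩ := exists_ringHom_singularHomology_map_one A
  letI : Module O (singularHomology ℤ ℤ (A.Points ℂ) 1) := Module.compHom _ (ρ.comp θ)
  have hsmul : ∀ (a : O) (x : singularHomology ℤ ℤ (A.Points ℂ) 1),
      a • x = (singularHomology.map ℤ ℤ (AlgPoints.mapContinuous (L := ℂ) (θ a).hom.hom.hom) 1).hom x := by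
    intro a x
    change (ρ (θ a)) x = _
    rw [hρ]
  have hpos : 0 < finrank ℤ O := finrank_pos
  rw [natCard_idealTorsion_eq_absNorm_pow_finrank θ hsmul 𝔞 h𝔞, ← finrank_int_mul_finrank_eq_two_mul_dim θ hsmul,
    Nat.mul_div_cancel_left _ hpos]

end Main

end Literature.AlgebraicGeometry.HodgeTheory.AbelianVariety

end
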